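import Mathlib
import HarnessLib
import Summits.ResolutionOfSingularities.ResolutionOfSingularities.Theorems.WildQuotientsWildQuotientResolutionS1aPointCentreRegrade
import Summits.ResolutionOfSingularities.ResolutionOfSingularities.Theorems.WildQuotientsWildQuotientResolutionS1aQhAwayDatum
import Summits.ResolutionOfSingularities.ResolutionOfSingularities.Theorems.WildQuotientsWildQuotientResolutionS1aAffineRecoordGraph
import Summits.ResolutionOfSingularities.ResolutionOfSingularities.Theorems.WildQuotientsWildQuotientResolutionS1aZeroLocusUnit
import Summits.ResolutionOfSingularities.ResolutionOfSingularities.Theorems.WildQuotientsWildQuotientResolutionS1aGraphTailLocal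

/-!
# S1a — R4e LEVEL 1, PER CRITICAL POINT: the recentred chart, the localised node `D(e⁻¹hhᵢ)` and its ADMISSIBLE ROOT `(x₀ : mᵢ+2, x₁−αᵢ : 1, x₂−g(αᵢ) : mᵢ+1)`

[OURS · L1 W4.5c · lead-1 g16; plan-1 RULING R-F15p ★ R4e-rational `graphTail_killsIn_two`, item (r3) of the lead-1 recipe: for the critical point `αᵢ` of `g`
(all critical points `k`-rational, local factorisation `g(X+αᵢ) − g(αᵢ) = X^{mᵢ+1}wᵢ` supplied) — recentre by ✓`FreeModel.exists_graph_recentre`, localise at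
`hhᵢ = ∏_{j≠i} N(x₁ + αᵢ − αⱼ)` (✓`GraphTail.sigma_locPoly`), and produce the node of `D(e⁻¹hhᵢ)` in the uniform trivial grading together with its admissible point-type
root by ✓`exists_pointCentre_away₀` (σ-adaptedness ✓`QhAway.qh_poly_map_le`, `hhᵢ(0) ≠ 0` ✓`eval_locPoly_ne_zero`, `V(x₀,x₁,x₂) ⊆ D(hhᵢ)`
✓`zeroLocus_inter_subset_basicOpen_of_sub_C_mem_span`)] — NOT statements of the manuscript; counted 0; AI-level work, weaker than expert review.
Crux stmt-ResolutionOfSingularities-17941 `CyclicQuotientFourfolds`, line `s1a-logminvertex` v13 (`stub_reachLowerInFX`).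
-/

set_option linter.dupNamespace false

noncomputable section

open CategoryTheory Limits AlgebraicGeometry TopologicalSpace Topology Opposite MvPolynomial
open Literature.AlgebraicGeometry.Resolution Literature.AlgebraicGeometry.RelativeSpec
open Summit.ResolutionOfSingularities.ResolutionOfSingularities.Theorems.WildQuotientResolution.S1
open Summit.ResolutionOfSingularities.ResolutionOfSingularities.Theorems.WildQuotientResolution.S1.NodeAtlas
open Summit.ResolutionOfSingularities.ResolutionOfSingularities.Theorems.WildQuotientResolution.S1.CoarseChart
open Summit.ResolutionOfSingularities.ResolutionOfSingularities.Theorems.WildQuotientResolution.S1.ProducerStep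
open Summit.ResolutionOfSingularities.ResolutionOfSingularities.Theorems.WildQuotientResolution.S1.NpFrame
open Summit.ResolutionOfSingularities.ResolutionOfSingularities.Theorems.WildQuotientResolution.S1.GoodCharts
open Summit.ResolutionOfSingularities.ResolutionOfSingularities.Theorems.WildQuotientResolution.S1.NodeAway
open Summit.ResolutionOfSingularities.ResolutionOfSingularities.Theorems.WildQuotientResolution.S1.NodeChartAway
open Summit.ResolutionOfSingularities.ResolutionOfSingularities.Theorems.WildQuotientResolution.S1.NodeTransport
open Summit.ResolutionOfSingularities.ResolutionOfSingularities.Theorems.WildQuotientResolution.S1.CentreAway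
open Summit.ResolutionOfSingularities.ResolutionOfSingularities.Theorems.WildQuotientResolution.S1.BlowupCharts
open Summit.ResolutionOfSingularities.ResolutionOfSingularities.Theorems.WildQuotientResolution.S1.KillCert

namespace Summit.ResolutionOfSingularities.ResolutionOfSingularities.Theorems.WildQuotientResolution.S1.GameFrame.GModel

variable {p : ℕ} {X' X₁ : Scheme.{0}} {q : X' ⟶ X₁} {G : Type} [Group G] {ρ : G →* Aut X'} {g₀ : G}

/-- Iterates of a conjugate automorphism. [folklore] -/
theorem iterate_conj_eq {R : Type} (γ : R ≃ R) (σ σ' : R → R) (h : ∀ x, σ' x = γ (σ (γ.symm x))) (n : ℕ) (x : R) :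
    σ'^[n] x = γ (σ^[n] (γ.symm x)) := by
  induction n generalizing x with
  | zero => simp
  | succ n ih => rw [Function.iterate_succ_apply', ih, h, γ.symm_apply_apply, ← Function.iterate_succ_apply' σ]

set_option maxHeartbeats 4000000 in
/-- ★★ **R4e LEVEL 1 AT THE CRITICAL POINT `αᵢ`**: recentred chart `eᵢ = γᵢ ∘ e` (`x₁ ↦ x₁ + αᵢ`, `x₂ ↦ x₂ + g(αᵢ)`), conjugate `σᵢ` in R4 normal form with tail
`x₂ − x₁^{mᵢ+1}wᵢ(x₁)`, the `σᵢ`-fixed localising polynomial `hhᵢ`, the node of `D(eᵢ⁻¹hhᵢ)` in the uniform trivial grading, and its admissible root of Veronese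
degree `d > 0` with centre chart `D(eᵢ⁻¹hhᵢ)`, `G`-stability, filtration clause, `VeroneseNormalised`, support in the chart. [OURS · L1 W4.5c · R4e; NOT a statement of the manuscript] -/
theorem exists_graphTail_pointCentre [Finite G] (hG : ∀ g : G, g ∈ Subgroup.zpowers g₀) (M : GModel p q G ρ g₀) [M.V.IsSeparated]
    (O : M.act.StableAffineOpens) (hO : IsAffineOpen O.1)
    {k : Type} [Field k] [Fact p.Prime] [CharP k p] (e : Γ(M.V, O.1) ≃+* (MvPolynomial (Fin 4) k)) (σ : (MvPolynomial (Fin 4) k) ≃+* (MvPolynomial (Fin 4) k)) (hC : ∀ a : k, σ (C a) = C a)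
    (h0 : σ (X 0) = X 0) (h1 : σ (X 1) = X 1 + X 0) (h2 : σ (X 2) = X 2) (g : Polynomial k)
    (h3 : σ (X 3) = X 3 + (X 2 - Polynomial.aeval (X 1 : (MvPolynomial (Fin 4) k)) g))
    (hact : ∀ t : Γ(M.V, O.1), actOEquiv M.act O g₀ t = e.symm (σ (e t))) (hσp : ∀ a : (MvPolynomial (Fin 4) k), (⇑σ)^[p] a = a)
    (hcl : ∀ S : Set Γ(M.V, O.1), IsClosed (M.V.zeroLocus (U := O.1) S ∩ (O.1 : Set M.V)))
    {r : ℕ} (α : Fin r → k) (hα : Function.Injective α) (m : Fin r → ℕ) (wloc : Fin r → Polynomial k)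
    (hwloc : ∀ i, g.comp (Polynomial.X + Polynomial.C (α i)) - Polynomial.C (g.eval (α i)) = Polynomial.X ^ (m i + 1) * wloc i) (i : Fin r) :
    ∃ (hh : (MvPolynomial (Fin 4) k)) (_ : hh = (∏ j ∈ Finset.univ.erase i, ∏ l : ZMod p, (X 1 + C (α i - α j) + (l.val : MvPolynomial (Fin 4) k) * X 0))) (γ : (MvPolynomial (Fin 4) k) ≃ₐ[k] (MvPolynomial (Fin 4) k)) (eᵢ : Γ(M.V, O.1) ≃+* (MvPolynomial (Fin 4) k)) (σᵢ : (MvPolynomial (Fin 4) k) ≃+* (MvPolynomial (Fin 4) k)) (hσh : σᵢ hh = hh)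
      (hactᵢ : ∀ t : Γ(M.V, O.1), actOEquiv M.act O g₀ t = eᵢ.symm (σᵢ (eᵢ t))),
      (∀ t, eᵢ t = γ (e t)) ∧
      (γ (X 0) = X 0 ∧ γ (X 1) = X 1 + C (α i) ∧ γ (X 2) = X 2 + C (g.eval (α i)) ∧ γ (X 3) = X 3 ∧
        γ.symm (X 0) = X 0 ∧ γ.symm (X 1) = X 1 - C (α i) ∧ γ.symm (X 2) = X 2 - C (g.eval (α i)) ∧ γ.symm (X 3) = X 3) ∧
      ((∀ a : k, σᵢ (C a) = C a) ∧ σᵢ (X 0) = X 0 ∧ σᵢ (X 1) = X 1 + X 0 ∧ σᵢ (X 2) = X 2 ∧ σᵢ (X 3) = X 3 + (X 2 - X 1 ^ (m i + 1) * Polynomial.aeval (X 1 : MvPolynomial (Fin 4) k) (wloc i) : MvPolynomial (Fin 4) k) ∧ (∀ a : (MvPolynomial (Fin 4) k), (⇑σᵢ)^[p] a = a)) ∧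
      ∃ (𝒜u : (Π j : Fin 0, ZMod ((![] : Fin 0 → ℕ) j)) → AddSubgroup (Localization.Away hh)) (_ : GradedRing 𝒜u) (eW : Γ(M.V, (basicOpenStable M.act O hO (actO_symm_eq_of_fixed hG M O eᵢ σᵢ hactᵢ hh hσh)).1) ≃+* ↥(𝒜u 0)),
        (∀ (d : (Π j : Fin 0, ZMod ((![] : Fin 0 → ℕ) j))) (x : (Localization.Away hh)), x ∈ 𝒜u d) ∧
        IsTameNode p (Localization.Away hh) 𝒜u (sigmaAway σᵢ hσh) ∧
        (∀ t' : Γ(M.V, (basicOpenStable M.act O hO (actO_symm_eq_of_fixed hG M O eᵢ σᵢ hactᵢ hh hσh)).1), ((eW ((M.act.aut g₀⁻¹).hom.appLE (basicOpenStable M.act O hO (actO_symm_eq_of_fixed hG M O eᵢ σᵢ hactᵢ hh hσh)).1 (basicOpenStable M.act O hO (actO_symm_eq_of_fixed hG M O eᵢ σᵢ hactᵢ hh hσh)).1 ((basicOpenStable M.act O hO (actO_symm_eq_of_fixed hG M O eᵢ σᵢ hactᵢ hh hσh)).2.1 g₀⁻¹).ge t') : ↥(𝒜u 0)) : (Localization.Away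 hh)) = sigmaAway σᵢ hσh ((eW t' : ↥(𝒜u 0)) : (Localization.Away hh))) ∧
        (∀ t : Γ(M.V, O.1), ((eW (algebraMap Γ(M.V, O.1) Γ(M.V, M.V.basicOpen (eᵢ.symm hh)) t) : ↥(𝒜u 0)) : (Localization.Away hh)) = algebraMap (MvPolynomial (Fin 4) k) (Localization.Away hh) (eᵢ t)) ∧
        ∃ (𝒦 : ReesFiltration M.V) (d : ℕ), 0 < d ∧ IsAdmissibleCentre p M.act g₀ 𝒦 d ∧ IsCentreChart p M.act g₀ 𝒦 d (basicOpenStable M.act O hO (actO_symm_eq_of_fixed hG M O eᵢ σᵢ hactᵢ hh hσh)) ∧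
          (∀ (g' : G) (n : ℕ), (𝒦.ideal n).comap (M.act.aut g').hom = 𝒦.ideal n) ∧
          (∀ n, (𝒦.filtration ⟨(basicOpenStable M.act O hO (actO_symm_eq_of_fixed hG M O eᵢ σᵢ hactᵢ hh hσh)).1, hO.basicOpen (eᵢ.symm hh)⟩).ideal n = ((traceFiltration 𝒜u (fun l => algebraMap (MvPolynomial (Fin 4) k) (Localization.Away hh) (X ((![0, 1, 2] : Fin 3 → Fin 4) l))) (![m i + 2, 1, m i + 1] : Fin 3 → ℕ)).ideal n).comap (eW : Γ(M.V, (basicOpenStable M.act O hO (actO_symm_eq_of_fixed hG M O eᵢ σᵢ hactᵢ hh hσh)).1) →+* ↥(𝒜u 0))) ∧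
          VeroneseNormalised 𝒜u (fun l => algebraMap (MvPolynomial (Fin 4) k) (Localization.Away hh) (X ((![0, 1, 2] : Fin 3 → Fin 4) l))) (![m i + 2, 1, m i + 1] : Fin 3 → ℕ) d ∧
          (((𝒦.ideal d).support : Set M.V)) ⊆ ((basicOpenStable M.act O hO (actO_symm_eq_of_fixed hG M O eᵢ σᵢ hactᵢ hh hσh)).1 : Set M.V) := by
  classical
  haveI : NeZero p := ⟨(Fact.out : p.Prime).ne_zero⟩
  -- recentre
  obtain ⟨γ, σ', hσ', hγ0, hγ1, hγ2, hγ3, hγs0, hγs1, hγs2, hγs3, hC', h0', h1', h2', h3'⟩ := FreeModel.exists_graph_recentre k σ hC h0 h1 h2 g h3 (α i)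
  have h3'' : σ' (X 3) = X 3 + (X 2 - X 1 ^ (m i + 1) * Polynomial.aeval (X 1 : MvPolynomial (Fin 4) k) (wloc i) : MvPolynomial (Fin 4) k) := by
    rw [h3', hwloc i, map_mul, map_pow, Polynomial.aeval_X]
  have hσp' : ∀ a : (MvPolynomial (Fin 4) k), (⇑σ')^[p] a = a := fun a => by
    rw [iterate_conj_eq γ.toEquiv σ σ' (fun x => hσ' x) p a]
    change γ ((⇑σ)^[p] (γ.symm a)) = a
    rw [hσp, γ.apply_symm_apply]
  let eᵢ : Γ(M.V, O.1) ≃+* (MvPolynomial (Fin 4) k) := e.trans γ.toRingEquiv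
  have heᵢ : ∀ t, eᵢ t = γ (e t) := fun _ => rfl
  have hactᵢ : ∀ t : Γ(M.V, O.1), actOEquiv M.act O g₀ t = eᵢ.symm (σ' (eᵢ t)) := fun t => by
    rw [hact t, hσ']
    change e.symm (σ (e t)) = e.symm (γ.symm (γ (σ (γ.symm (γ (e t))))))
    rw [γ.symm_apply_apply, γ.symm_apply_apply]
  have hσh : σ' (∏ j ∈ Finset.univ.erase i, ∏ l : ZMod p, (X 1 + C (α i - α j) + (l.val : MvPolynomial (Fin 4) k) * X 0)) = (∏ j ∈ Finset.univ.erase i, ∏ l : ZMod p, (X 1 + C (α i - α j) + (l.val : MvPolynomial (Fin 4) k) * X 0)) := GraphTail.sigma_locPoly σ' hC' h0' h1' (Finset.univ.erase i) (fun j => α i - α j)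
  -- the hypotheses of the point-centre producer
  have hw0 : (![m i + 2, 1, m i + 1] : Fin 3 → ℕ) 0 = (![m i + 2, 1, m i + 1] : Fin 3 → ℕ) 1 + (m i + 1) := by change m i + 2 = 1 + (m i + 1); ring
  have hσJ : ∀ n : ℕ, ((weightedFiltration ((X : Fin 4 → (MvPolynomial (Fin 4) k)) ∘ (![0, 1, 2] : Fin 3 → Fin 4)) (![m i + 2, 1, m i + 1] : Fin 3 → ℕ)).ideal n).map (σ' : (MvPolynomial (Fin 4) k) →+* (MvPolynomial (Fin 4) k)) ≤
      (weightedFiltration ((X : Fin 4 → (MvPolynomial (Fin 4) k)) ∘ (![0, 1, 2] : Fin 3 → Fin 4)) (![m i + 2, 1, m i + 1] : Fin 3 → ℕ)).ideal n :=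
    fun n => QhAway.qh_poly_map_le σ' hC' h0' h1' h2' (X 2 - X 1 ^ (m i + 1) * Polynomial.aeval (X 1 : MvPolynomial (Fin 4) k) (wloc i) : MvPolynomial (Fin 4) k) h3'' (![m i + 2, 1, m i + 1] : Fin 3 → ℕ) (m i + 1) hw0 (GraphTail.graphTail_mem (m i) (wloc i)) n
  have hne : ∀ j ∈ Finset.univ.erase i, α i - α j ≠ 0 := fun j hj h => Finset.ne_of_mem_erase hj (hα (sub_eq_zero.mp h)).symm
  have hu : MvPolynomial.eval (fun _ : Fin 4 => (0 : k)) (∏ j ∈ Finset.univ.erase i, ∏ l : ZMod p, (X 1 + C (α i - α j) + (l.val : MvPolynomial (Fin 4) k) * X 0)) ≠ 0 := GraphTail.eval_locPoly_ne_zero (Finset.univ.erase i) (fun j => α i - α j) hne _ rfl rfl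
  have hcst : (∏ j ∈ Finset.univ.erase i, (α i - α j) ^ p) ≠ 0 := Finset.prod_ne_zero_iff.mpr fun j hj => pow_ne_zero _ (hne j hj)
  have hZW := Scheme.zeroLocus_inter_subset_basicOpen_of_sub_C_mem_span (U := O.1) eᵢ (![0, 1, 2] : Fin 3 → Fin 4) (∏ j ∈ Finset.univ.erase i, ∏ l : ZMod p, (X 1 + C (α i - α j) + (l.val : MvPolynomial (Fin 4) k) * X 0)) _ hcst
    (GraphTail.locPoly_sub_C_mem_span (Finset.univ.erase i) (fun j => α i - α j))
  obtain ⟨𝒜u, gr, eW, hfull, htame, hσW, hpin, 𝒦, d, hd, hadm, hchart, hG𝒦, hfil, hver, hsupp⟩ :=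
    exists_pointCentre_away₀ hG M O hO eᵢ σ' hactᵢ hσp' (∏ j ∈ Finset.univ.erase i, ∏ l : ZMod p, (X 1 + C (α i - α j) + (l.val : MvPolynomial (Fin 4) k) * X 0)) hσh (c := 3) (by norm_num) (![0, 1, 2] : Fin 3 → Fin 4) (by decide) (![m i + 2, 1, m i + 1] : Fin 3 → ℕ)
      (fun l => by fin_cases l <;> simp) hσJ (fun _ => 0) (fun _ => rfl) hu (hcl _) hZW
  exact ⟨(∏ j ∈ Finset.univ.erase i, ∏ l : ZMod p, (X 1 + C (α i - α j) + (l.val : MvPolynomial (Fin 4) k) * X 0)), rfl, γ, eᵢ, σ', hσh, hactᵢ, heᵢ, ⟨hγ0, hγ1, hγ2, hγ3, hγs0, hγs1, hγs2, hγs3⟩, ⟨hC', h0', h1', h2', h3'', hσp'⟩,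
    𝒜u, gr, eW, hfull, htame, hσW, hpin, 𝒦, d, hd, hadm, hchart, hG𝒦, hfil, hver, hsupp⟩

end Summit.ResolutionOfSingularities.ResolutionOfSingularities.Theorems.WildQuotientResolution.S1.GameFrame.GModel

end
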